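import Mathlib
import Summits.Ventures.PercRepro2.LocRows
import Summits.Ventures.PercRepro2.SwRow
import Summits.Ventures.PercRepro2.SwOut
import Summits.Ventures.PercRepro2.SwAllRow
import Summits.Ventures.PercRepro2.SwOutAll
import Summits.Ventures.PercRepro2.SwOutArmFlip
import Summits.Ventures.PercRepro2.SwOutArmThm
import Summits.Ventures.PercRepro2.SwOutCoreDefs
import Summits.Ventures.PercRepro2.SwOutBigBlockDefs
import Summits.Ventures.PercRepro2.SwOutMixedBaseDefs
import Summits.Ventures.PercRepro2.SwOutMixedBaseClasses
import Summits.Ventures.PercRepro2.SwOutMixedBaseHull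
import Summits.Ventures.PercRepro2.SwOutMixedBaseDual
import Summits.Ventures.PercRepro2.SwOutMixedCore
import Summits.Ventures.PercRepro2.SwOutMixedCoreEdgeMap

/-!
# The non-leaking realisations are class points (blind cell PercRepro2, night-4 g18, 2026-08-27;
proofs/NIGHT4-G18.md §6, item (G1 ⇐) in the vocabulary of the classes)

`mixedReal_mem_outClass`: at a non-leaking point the realisation of a mixed base lies in the
outside class `outClass Us h ξ` of the region `Us ⊇ {h, u, p} ∪ arms` whenever the base does —
off the edges touching `Us` nothing is flipped (every class touches `u`, `p` or an arm), and the
hull of `h` lies in `{h, u, p} ∪ arms` (`hull_mixedReal_subset`).  Hence the block `blockC`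
(`SwOutMixedCoreBlockThm`) is a subset of the class `swOutSide`'s region class.  Conversely
(`not_hull_subset_of_leakR`, item (G1 ⇒)): at a red-side leaking point the hull of `h` leaves the
region — through a red outside edge of `p`, or through a red dead edge into the blue h-piece and
one of its red boundary edges — under the non-degeneracy of NIGHT4-G17.md §4⁗ (an outside edge
and a dead edge at `p`; the outside neighbours of `p` and the boundary neighbours of the h-piece
outside the region).  The blue-side statement is its dual.
-/

namespace Summit.Ventures.PercRepro2

namespace BigBlock

open Hull LocRows

open scoped Classical

variable {V : Type*} {E : Type*}

section Class

variable {ι κ : Type*} {ends : E → Sym2 V} {σ : Config E} {h u p : V} {U : ι → Set V} {Ah : Set V}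
  {F : κ → Set V} (hb : MixedBase ends σ h u p U Ah F)
include hb

omit hb in
/-- An edge not touching the region is in no class. -/
lemma mixedReal_eq_of_not_touches {Us : Set V}
    (hUs : {h} ∪ {u} ∪ {p} ∪ armsAll U Ah F ⊆ Us) {q : Pt ι κ} {e : E}
    (he : e ∉ touches ends Us) : mixedReal ends u p U Ah F σ q e = σ e := by
  have hu : u ∈ Us := hUs (Or.inl (Or.inl (Or.inr rfl)))
  have hp : p ∈ Us := hUs (Or.inl (Or.inr rfl))
  refine MixedBase.mixedReal_apply_none (fun j hj => he ?_) (fun hA => he ?_) (fun hUP => he ?_)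
    (fun hX => he ?_) (fun k hk => he ?_)
  · obtain ⟨x, hx, y, hxy⟩ := hj
    exact ⟨x, hUs (Or.inr (Or.inl (Or.inl (Set.mem_iUnion.2 ⟨j, hx⟩)))), y, hxy⟩
  · obtain ⟨x, hx, y, hxy⟩ := hA
    exact ⟨x, hUs (Or.inr (Or.inl (Or.inr hx))), y, hxy⟩
  · exact ⟨u, hu, p, hUP⟩
  · obtain ⟨x, hpx, _, _⟩ := hX
    exact ⟨p, hp, x, hpx⟩
  · obtain ⟨x, hx, y, hxy⟩ := hk
    exact ⟨x, hUs (Or.inr (Or.inr (Set.mem_iUnion.2 ⟨k, hx⟩))), y, hxy⟩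

/-- **The non-leaking realisations are class points**: with the base in the outside class of the
region, so is the realisation of every non-leaking point. -/
theorem MixedBase.mixedReal_mem_outClass [Fintype E] [DecidableEq E]
    (hup : ∃ e, ends e = s(u, p)) {Us : Set V}
    (hUs : {h} ∪ {u} ∪ {p} ∪ armsAll U Ah F ⊆ Us) {ξ : Config E}
    (hσ : ∀ e, e ∉ touches ends Us → σ e = ξ e) {q : Pt ι κ} (hqR : ¬ LeakR q)
    (hqB : ¬ LeakB q) : mixedReal ends u p U Ah F σ q ∈ outClass ends Us h ξ := by
  simp only [outClass, Finset.mem_filter, Finset.mem_univ, true_and]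
  refine ⟨fun e he => ?_, fun x hx => hUs (hb.hull_mixedReal_subset hup hqR hqB hx)⟩
  rw [mixedReal_eq_of_not_touches hUs he]
  exact hσ e he

/-- `p` is in the red cluster of `h` when some u-arm is red and the u–p edges are red. -/
lemma MixedBase.p_mem_cluster_of_red (hup : ∃ e, ends e = s(u, p)) {q : Pt ι κ} {j : ι}
    (hj : q.1 j = true) (huP : q.2.2.1 = true) :
    p ∈ cluster ends (mixedReal ends u p U Ah F σ q) h := by
  obtain ⟨e, x, hex, hx⟩ := hb.u_adj_U j
  have hxc : x ∈ cluster ends (mixedReal ends u p U Ah F σ q) h :=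
    cluster_mono (hb.insideConfig_U_le hj) h (hb.U_conn j x hx)
  have hred : mixedReal ends u p U Ah F σ q e = true := by
    rw [hb.mixedReal_U_red hj ⟨x, hx, u, ends_swap hex⟩]
    exact hb.u_red e x hex
  have huc := mem_cluster_of_edge hxc hred (ends_swap hex)
  obtain ⟨e', hup'⟩ := hup
  have hred' : mixedReal ends u p U Ah F σ q e' = true := by
    rw [hb.mixedReal_apply_UP hup', if_pos huP]
    exact hb.u_red e' p hup'
  exact mem_cluster_of_edge huc hred' hup'

/-- **(G1 ⇒) A red-side leaking point is not a class point**: its hull of `h` leaves the region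
(through an outside edge of `p`, red, or through a dead edge and a boundary edge of the blue
h-piece, both red) — assuming `p` has an outside edge and a dead edge, the outside neighbours of
`p` and the boundary neighbours of the h-piece lie outside the region. -/
theorem MixedBase.not_hull_subset_of_leakR [Fintype E] [DecidableEq E]
    (hup : ∃ e, ends e = s(u, p)) {Us : Set V}
    (hext : ∃ e, e ∈ clsExt ends u p Ah)
    (hext_out : ∀ e x, ends e = s(p, x) → x ≠ u → x ∉ Ah → x ∉ Us)
    (hdead : ∃ e y, ends e = s(p, y) ∧ y ∈ Ah)
    (hbdry : ∀ y ∈ Ah, ∃ e z, ends e = s(y, z) ∧ z ≠ h ∧ z ≠ u ∧ z ≠ p ∧ z ∉ armsAll U Ah F ∧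
      z ∉ Us)
    {q : Pt ι κ} (hq : LeakR q) :
    ¬ (hull ends (mixedReal ends u p U Ah F σ q) h ⊆ Us) := by
  intro hsub
  obtain ⟨⟨j, hj⟩, huP, hea⟩ := hq
  have hpc := hb.p_mem_cluster_of_red hup hj huP
  rcases hea with he | ha
  · -- the outside edges of `p` are red: an outside neighbour is in the hull
    obtain ⟨e, hx⟩ := hext
    have hcol : mixedReal ends u p U Ah F σ q e = true := by
      obtain ⟨x, hpx, hxu, hxA⟩ := hx
      rw [hb.mixedReal_apply_Ext ⟨x, hpx, hxu, hxA⟩, if_neg (by simp [he]),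
        hb.ext_blue e x hpx hxu hxA]
      rfl
    obtain ⟨x, hpx, hxu, hxA⟩ := hx
    exact hext_out e x hpx hxu hxA (hsub (Or.inl (mem_cluster_of_edge hpc hcol hpx)))
  · -- the dead edges are red (the h-piece blue), and so are its boundary edges
    obtain ⟨e, y, hpy, hyA⟩ := hdead
    have hcol : mixedReal ends u p U Ah F σ q e = true := by
      rw [hb.mixedReal_apply_Ah ⟨y, hyA, p, ends_swap hpy⟩, if_neg (by simp [ha]),
        hb.dead_blue e y hpy hyA]
      rfl
    have hyc := mem_cluster_of_edge hpc hcol hpy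
    obtain ⟨e', z, hyz, hzh, hzu, hzp, hzA, hzU⟩ := hbdry y hyA
    have hcol' : mixedReal ends u p U Ah F σ q e' = true := by
      rw [hb.mixedReal_apply_Ah ⟨y, hyA, z, hyz⟩, if_neg (by simp [ha]),
        hb.bdry_blue e' y z hyz (Or.inl (Or.inr hyA)) hzh hzu hzp hzA]
      rfl
    exact hzU (hsub (Or.inl (mem_cluster_of_edge hyc hcol' hyz)))

end Class

end BigBlock

end Summit.Ventures.PercRepro2
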